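/-
Copyright (c) 2026 the pub-hodgecm-mathlib formalisation cell (harness21).  Prover seat hodgecm-mathlib-K2Liu-p02 (g8), Track B «K2-LIT» ∕ hLiu418
#184♮, Road I v3, unit U5 STEP C — the #42F′ TOP, EDITION 7: BYTE GUARDS of the predicates of record (RULING M-158o (a); pattern ★ p862620 `e1St1383Letter_iff`).
-/
import Summits.HodgeConjecture.HodgeConjecture.Theorems.K2LiuFirstTermIdentityFaceDefs   -- ED. 7 predicates of record
import HarnessLib

/-!
# K2_Liu road (hLiu418), Road I v3, U5 STEP C — EDITION 7: BYTE GUARDS `admissibleOn_iff` ∕ `thetaValuedOn_iff` ∕ `rigidityRowsOn_iff`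

Cell `pub/hodgecm-mathlib` (D-0151), Track B.  Each predicate of ★ `K2LiuFirstTermIdentityFaceDefs` IS its ★ ED. 6 byte block — definitionally (`Iff.rfl`) — so the two
assemblers and the typist rewrite by `(X_iff …).1 ∕ .2` and never depend on `unfold` reducibility (RULING M-158o (a)).  THEOREMS ONLY; no `sorry`; axioms ⊆ {propext,
Classical.choice, Quot.sound}.  HONEST LABEL: HC_CM is proved only modulo the 7 printed citations (2 remaining named inputs: hLiu418 = stmt-HodgeConjecture-24832, h413 = stmt-HodgeConjecture-24833) until rung 0 closes; kernel lane `--supports stmt-HodgeConjecture-24832 --as helper`, closes nothing.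
References: [KudlaRallis1994] Ann. of Math. 140 (1994) §1 Thm. 1.1, §3; [GanQiuTakeda2014] Invent. Math. 198 (2014) §7.2 Thm. 20 (i).
-/

set_option autoImplicit false
set_option linter.dupNamespace false

noncomputable section
open scoped Matrix Topology TensorProduct SchwartzMap Classical  -- `Classical`: the `Fintype` of real ∕ complex places inside `mixedSpace (L⁺)` (as in ★ U2f)
open NumberField NumberField.mixedEmbedding IsDedekindDomain MeasureTheory Filter
open Literature.NumberTheory.Automorphic Literature.NumberTheory.Automorphic.UnitaryGroup Literature.NumberTheory.GaloisRepresentations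
open Literature.NumberTheory.GelbartRogawski1991 Literature.NumberTheory.GelbartRogawski1991.GRConstruction
open Literature.NumberTheory.GelbartRogawski1991.UnitaryDualPair
open Literature.NumberTheory.K2Lit.SiegelDoubled Literature.NumberTheory.K2Lit.DoubledLineTheta
open Literature.NumberTheory.Automorphic.IdeleClassGroup
open Literature.NumberTheory.Automorphic.Liu2021
open Literature.NumberTheory.Automorphic.Liu2021.Def411WeilCarriers
open Literature.NumberTheory.Automorphic.Liu2021.Def411WeilCarriersDoubling
open Literature.NumberTheory.Weil1964
open Literature.RepresentationTheory.Liu2021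
open Literature.RepresentationTheory.HarrisKudlaSweet1996 (IsSplittingChar)
open Summit.HodgeConjecture.HodgeConjecture.Cruxes.HLiu418.K2LiuFirstTermResidueFormDefs (resNorm)
open Summit.HodgeConjecture.HodgeConjecture.Cruxes.HLiu418.K2LiuFirstTermIdentityFaceDefs

namespace Summit.HodgeConjecture.HodgeConjecture.Cruxes.HLiu418.K2LiuFirstTermIdentityFaceDefsIff

set_option maxHeartbeats 4000000 in
/-- BYTE GUARD: `AdmissibleOn … V T₁` IS ★ 0c's (a) ∧ (b) ∧ (c) (★ ED. 6 lines 152–189) — definitionally. [cite: KudlaRallis1994, §1 Thm. 1.1] -/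
theorem admissibleOn_iff (L : Type) [Field L] [NumberField L] [IsCMField L] {n : ℕ} (e : Fin 2 × Fin 1 ≃ Fin n)
    (dV : Fin 2 → L) (hdV : ∀ i, IsCMField.complexConj L (dV i) = dV i) (hdV0 : ∀ i, dV i ≠ 0)
    (dW : Fin 1 → L) (hdW : ∀ i, IsCMField.complexConj L (dW i) = dW i) (hdW0 : ∀ i, dW i ≠ 0)
    {M' n' : ℕ} (eW : Fin 1 × Fin 3 ≃ Fin M') (e' : Fin 2 × Fin M' ≃ Fin n')
    (dV' : Fin 3 → L) (hdV' : ∀ k, IsCMField.complexConj L (dV' k) = dV' k) (hdV'0 : ∀ k, dV' k ≠ 0)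
    (χb : HeckeCharacter L) (hχbu : χb.IsUnitary) (hχbs : Literature.RepresentationTheory.HarrisKudlaSweet1996.IsSplittingChar L 1 χb)
    (α : UnitaryGroup.adelicOne (Fp L) L (IsCMField.complexConj L) →* ℂˣ) (𝒦 : IwasawaDatum L e dV hdV dW hdW)
    (V : Submodule ℂ 𝓢(((Fin (n' + n')) → mixedSpace (Fp L)), ℂ))
        (T₁ : ↥(Submodule.span ℂ {x : piSchwartzBruhat (Fp L) (Fin (n' + n')) |
            ∃ a ∈ V, ∃ f : FinSB (Fp L) (Fin (n' + n')), x = piSchwartzBruhatEquiv (Fp L) (Fin (n' + n')) (a ⊗ₜ[ℂ] f)}) →ₗ[ℂ]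
            (HA L e dV hdV dW hdW → ℂ)) :
    AdmissibleOn L e dV hdV hdV0 dW hdW hdW0 eW e' dV' hdV' hdV'0 χb hχbu hχbs α 𝒦 V T₁ ↔
    (    -- (a) ★ 0c: the value on ANY pole-cleared continuation of `E^Δ(s; g_x)`
        (∀ (x : ↥(Submodule.span ℂ {x : piSchwartzBruhat (Fp L) (Fin (n' + n')) |
            ∃ a ∈ V, ∃ f : FinSB (Fp L) (Fin (n' + n')), x = piSchwartzBruhatEquiv (Fp L) (Fin (n' + n')) (a ⊗ₜ[ℂ] f)}))
          (Pg : Finset ℂ) (Eg : ℂ → HA L e dV hdV dW hdW → ℂ),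
          (∀ h : HA L e dV hdV dW hdW, DifferentiableOn ℂ (fun s => Eg s h) {s : ℂ | 0 < s.re}) →
          (∀ (s : ℂ) (h : HA L e dV hdV dW hdW), (n : ℝ) / 2 < s.re →
            Eg s h = (∏ p ∈ Pg, (s - p)) * eisensteinFamilyDelta L e dV hdV dW hdW
              (fun s₁ h₁ => ((DoubledWeilDetTwist.detChar L e dV hdV hdV0 dW hdW hdW0 α h₁ : ℂˣ) : ℂ) *
                stdExtension 𝒦 ((((3 : ℕ) : ℂ) - (n : ℂ)) / 2)
                  (swSectionTensor L e dV hdV dW hdW eW e' dV' hdV' hdV0 hdW0 hdV'0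
                    (doubledWeilRep L e' dV hdV hdV0 (tensorFrame L dW eW dV') (tensorFrame_real L dW hdW eW dV' hdV')
                      (tensorFrame_ne_zero L dW eW dV' hdW0 hdV'0) χb hχbu hχbs)
                    (x : piSchwartzBruhat (Fp L) (Fin (n' + n')))) s₁ h₁) s h) →
          T₁ x = resNorm Pg Eg) ∧
        -- (b) ★ 0c: `T₁ x` IS the residue form of a continuation with ALL FIVE clauses of #41
        (∀ x : ↥(Submodule.span ℂ {x : piSchwartzBruhat (Fp L) (Fin (n' + n')) |
            ∃ a ∈ V, ∃ f : FinSB (Fp L) (Fin (n' + n')), x = piSchwartzBruhatEquiv (Fp L) (Fin (n' + n')) (a ⊗ₜ[ℂ] f)}),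
          ∃ (P : Finset ℂ) (Es : ℂ → HA L e dV hdV dW hdW → ℂ),
            ((∀ h : HA L e dV hdV dW hdW, DifferentiableOn ℂ (fun s => Es s h) {s : ℂ | 0 < s.re}) ∧
            (∀ s : ℂ, 0 < s.re → Continuous (Es s)) ∧
            (∀ s : ℂ, 0 < s.re → ∀ (γ : ratH L e dV hdV dW hdW) (h : HA L e dV hdV dW hdW),
              Es s ((γ : HA L e dV hdV dW hdW) * h) = Es s h) ∧
            (∀ (s : ℂ) (h : HA L e dV hdV dW hdW), (n : ℝ) / 2 < s.re →
              Es s h = (∏ p ∈ P, (s - p)) * eisensteinFamilyDelta L e dV hdV dW hdW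
                (fun s₁ h₁ => ((DoubledWeilDetTwist.detChar L e dV hdV hdV0 dW hdW hdW0 α h₁ : ℂˣ) : ℂ) *
                  stdExtension 𝒦 ((((3 : ℕ) : ℂ) - (n : ℂ)) / 2)
                    (swSectionTensor L e dV hdV dW hdW eW e' dV' hdV' hdV0 hdW0 hdV'0
                      (doubledWeilRep L e' dV hdV hdV0 (tensorFrame L dW eW dV') (tensorFrame_real L dW hdW eW dV' hdV')
                        (tensorFrame_ne_zero L dW eW dV' hdW0 hdV'0) χb hχbu hχbs)
                      (x : piSchwartzBruhat (Fp L) (Fin (n' + n')))) s₁ h₁) s h) ∧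
            (∀ z : ℂ, 0 < z.re → ∃ C A r : ℝ, 0 < r ∧ ∀ s : ℂ, dist s z < r → ∀ h : HA L e dV hdV dW hdW,
              ‖Es s h‖ ≤ C * adelicHeightGL (n + n) L (h : GL (Fin (n + n)) (AdeleRing (𝓞 L) L)) ^ A)) ∧
            T₁ x = resNorm P Es) ∧
        -- (c) ★ 0c: continuous, left-`H(L⁺)`-invariant, of moderate growth
        (∀ x, Continuous (T₁ x)) ∧
        (∀ x (γ : ratH L e dV hdV dW hdW) (h : HA L e dV hdV dW hdW), T₁ x ((γ : HA L e dV hdV dW hdW) * h) = T₁ x h) ∧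
        (∀ x, ∃ C A : ℝ, ∀ h : HA L e dV hdV dW hdW,
          ‖T₁ x h‖ ≤ C * adelicHeightGL (n + n) L (h : GL (Fin (n + n)) (AdeleRing (𝓞 L) L)) ^ A)) :=
  Iff.rfl

set_option maxHeartbeats 4000000 in
/-- BYTE GUARD: `ThetaValuedOn … V T₁` IS «`∀ x, ∃ Φ′, ∀ h, T₁ x h = B(Φ′, fw) h`» (★ ED. 1 FACE-R's conclusion, lines 200–206) — definitionally. [cite: GanQiuTakeda2014, §7.2 Thm. 20 (i)] -/
theorem thetaValuedOn_iff (L : Type) [Field L] [NumberField L] [IsCMField L] {n : ℕ} (e : Fin 2 × Fin 1 ≃ Fin n)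
    (dV : Fin 2 → L) (hdV : ∀ i, IsCMField.complexConj L (dV i) = dV i) (hdV0 : ∀ i, dV i ≠ 0)
    (dW : Fin 1 → L) (hdW : ∀ i, IsCMField.complexConj L (dW i) = dW i) (hdW0 : ∀ i, dW i ≠ 0)
    (lam : Literature.NumberTheory.Automorphic.IdeleClassGroup L →ₜ* Circle) (hlam : IsConjugateSymplectic L lam)
    {n'' : ℕ} (e₁ : Fin (n + n) × Fin 1 ≃ Fin n'') (a' : (↥(maximalRealSubfield L))ˣ)
        (hρ : HasThetaMajorants fun
          (p : ↥(UnitaryGroup.adelic (↥(maximalRealSubfield L)) L (IsCMField.complexConj L) (n + n) (Matrix.diagonal (dD L e dV hdV dW hdW))) ×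
            ↥(UnitaryGroup.adelic (↥(maximalRealSubfield L)) L (IsCMField.complexConj L) 1 (JW (↥(maximalRealSubfield L)) L a')))
          (Ψ : piSchwartzBruhat (↥(maximalRealSubfield L)) (Fin n'')) =>
            pairRep (↥(maximalRealSubfield L)) L (IsCMField.complexConj L) (n + n) 1 e₁ (Matrix.diagonal (dD L e dV hdV dW hdW)) (JW (↥(maximalRealSubfield L)) L a')
              (chiSplittingLine L e₁ (dD L e dV hdV dW hdW) (dD_conj L e dV hdV dW hdW) (dD_ne_zero L e dV hdV dW hdW hdV0 hdW0)
                (toHeckeCharacter L lam⁻¹) (isUnitary_toHeckeCharacter L lam⁻¹)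
                ((isOscillatorChar_toHeckeCharacter_iff lam⁻¹).mpr (K2LiuConjugateSymplecticInv.IsConjugateSymplectic.inv hlam)) (TW (↥(maximalRealSubfield L)) a')
                (isUnit_det_TW (↥(maximalRealSubfield L)) a') (JW (↥(maximalRealSubfield L)) L a') (JW_eq (↥(maximalRealSubfield L)) L a'))
              p Ψ)
        (μW : @Measure (↥(UnitaryGroup.adelic (↥(maximalRealSubfield L)) L (IsCMField.complexConj L) 1 (JW (↥(maximalRealSubfield L)) L a')) ⧸
          (UnitaryGroup.toAdelic (↥(maximalRealSubfield L)) L (IsCMField.complexConj L) 1 (JW (↥(maximalRealSubfield L)) L a')).range) (borel _))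
        (fw : C(↥(UnitaryGroup.adelic (↥(maximalRealSubfield L)) L (IsCMField.complexConj L) 1 (JW (↥(maximalRealSubfield L)) L a')) ⧸
          (UnitaryGroup.toAdelic (↥(maximalRealSubfield L)) L (IsCMField.complexConj L) 1 (JW (↥(maximalRealSubfield L)) L a')).range, ℂ))
    {n' : ℕ} (V : Submodule ℂ 𝓢(((Fin (n' + n')) → mixedSpace (Fp L)), ℂ))
        (T₁ : ↥(Submodule.span ℂ {x : piSchwartzBruhat (Fp L) (Fin (n' + n')) |
            ∃ a ∈ V, ∃ f : FinSB (Fp L) (Fin (n' + n')), x = piSchwartzBruhatEquiv (Fp L) (Fin (n' + n')) (a ⊗ₜ[ℂ] f)}) →ₗ[ℂ]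
            (HA L e dV hdV dW hdW → ℂ)) :
    ThetaValuedOn L e dV hdV hdV0 dW hdW hdW0 lam hlam e₁ a' hρ μW fw V T₁ ↔
    (∀ x : ↥(Submodule.span ℂ {x : piSchwartzBruhat (Fp L) (Fin (n' + n')) |
        ∃ a ∈ V, ∃ f : FinSB (Fp L) (Fin (n' + n')), x = piSchwartzBruhatEquiv (Fp L) (Fin (n' + n')) (a ⊗ₜ[ℂ] f)}),
      ∃ Φ' : piSchwartzBruhat (↥(maximalRealSubfield L)) (Fin n''),
        ∀ h : HA L e dV hdV dW hdW,
          T₁ x h = @doubledLineThetaLift L _ _ _ 2 1 n e dV hdV dW hdW n'' e₁ hdV0 hdW0 lam⁻¹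
            (K2LiuConjugateSymplecticInv.IsConjugateSymplectic.inv hlam) a' hρ (borel _) μW Φ' fw h) :=
  Iff.rfl

set_option maxHeartbeats 4000000 in
/-- BYTE GUARD: `RigidityRowsOn … V T₁` IS ★ ED. 6's row block lines 190–236 (`∃ 𝓣 T₂ … ∃ P … rows ∧ ∃ c₁, h₁`) — definitionally. [cite: KudlaRallis1994, §1 Thm. 1.1, §3] -/
theorem rigidityRowsOn_iff (L : Type) [Field L] [NumberField L] [IsCMField L] {n : ℕ} (e : Fin 2 × Fin 1 ≃ Fin n)
    (dV : Fin 2 → L) (hdV : ∀ i, IsCMField.complexConj L (dV i) = dV i) (hdV0 : ∀ i, dV i ≠ 0)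
    (dW : Fin 1 → L) (hdW : ∀ i, IsCMField.complexConj L (dW i) = dW i) (hdW0 : ∀ i, dW i ≠ 0)
    (lam : Literature.NumberTheory.Automorphic.IdeleClassGroup L →ₜ* Circle) (hlam : IsConjugateSymplectic L lam)
    {n'' : ℕ} (e₁ : Fin (n + n) × Fin 1 ≃ Fin n'') (a' : (↥(maximalRealSubfield L))ˣ)
        (hρ : HasThetaMajorants fun
          (p : ↥(UnitaryGroup.adelic (↥(maximalRealSubfield L)) L (IsCMField.complexConj L) (n + n) (Matrix.diagonal (dD L e dV hdV dW hdW))) ×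
            ↥(UnitaryGroup.adelic (↥(maximalRealSubfield L)) L (IsCMField.complexConj L) 1 (JW (↥(maximalRealSubfield L)) L a')))
          (Ψ : piSchwartzBruhat (↥(maximalRealSubfield L)) (Fin n'')) =>
            pairRep (↥(maximalRealSubfield L)) L (IsCMField.complexConj L) (n + n) 1 e₁ (Matrix.diagonal (dD L e dV hdV dW hdW)) (JW (↥(maximalRealSubfield L)) L a')
              (chiSplittingLine L e₁ (dD L e dV hdV dW hdW) (dD_conj L e dV hdV dW hdW) (dD_ne_zero L e dV hdV dW hdW hdV0 hdW0)
                (toHeckeCharacter L lam⁻¹) (isUnitary_toHeckeCharacter L lam⁻¹)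
                ((isOscillatorChar_toHeckeCharacter_iff lam⁻¹).mpr (K2LiuConjugateSymplecticInv.IsConjugateSymplectic.inv hlam)) (TW (↥(maximalRealSubfield L)) a')
                (isUnit_det_TW (↥(maximalRealSubfield L)) a') (JW (↥(maximalRealSubfield L)) L a') (JW_eq (↥(maximalRealSubfield L)) L a'))
              p Ψ)
        (μW : @Measure (↥(UnitaryGroup.adelic (↥(maximalRealSubfield L)) L (IsCMField.complexConj L) 1 (JW (↥(maximalRealSubfield L)) L a')) ⧸
          (UnitaryGroup.toAdelic (↥(maximalRealSubfield L)) L (IsCMField.complexConj L) 1 (JW (↥(maximalRealSubfield L)) L a')).range) (borel _))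
        (fw : C(↥(UnitaryGroup.adelic (↥(maximalRealSubfield L)) L (IsCMField.complexConj L) 1 (JW (↥(maximalRealSubfield L)) L a')) ⧸
          (UnitaryGroup.toAdelic (↥(maximalRealSubfield L)) L (IsCMField.complexConj L) 1 (JW (↥(maximalRealSubfield L)) L a')).range, ℂ))
    {n' : ℕ} (V : Submodule ℂ 𝓢(((Fin (n' + n')) → mixedSpace (Fp L)), ℂ))
        (T₁ : ↥(Submodule.span ℂ {x : piSchwartzBruhat (Fp L) (Fin (n' + n')) |
            ∃ a ∈ V, ∃ f : FinSB (Fp L) (Fin (n' + n')), x = piSchwartzBruhatEquiv (Fp L) (Fin (n' + n')) (a ⊗ₜ[ℂ] f)}) →ₗ[ℂ]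
            (HA L e dV hdV dW hdW → ℂ)) :
    RigidityRowsOn L e dV hdV hdV0 dW hdW hdW0 lam hlam e₁ a' hρ μW fw V T₁ ↔
    (∃ (𝓣 : ↥(Submodule.span ℂ {x : piSchwartzBruhat (Fp L) (Fin (n' + n')) |
        ∃ a ∈ V, ∃ f : FinSB (Fp L) (Fin (n' + n')), x = piSchwartzBruhatEquiv (Fp L) (Fin (n' + n')) (a ⊗ₜ[ℂ] f)}) →ₗ[ℂ]
          piSchwartzBruhat (↥(maximalRealSubfield L)) (Fin n''))
      (T₂ : ↥(Submodule.span ℂ {x : piSchwartzBruhat (Fp L) (Fin (n' + n')) |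
          ∃ a ∈ V, ∃ f : FinSB (Fp L) (Fin (n' + n')), x = piSchwartzBruhatEquiv (Fp L) (Fin (n' + n')) (a ⊗ₜ[ℂ] f)}) →ₗ[ℂ] (HA L e dV hdV dW hdW → ℂ)),
      -- the theta side IS the doubled line theta lift after the carrier `𝓣` (★ D8 at `λ⁻¹`, bytes of #42F′'s conclusion)
      (∀ x (h : HA L e dV hdV dW hdW), T₂ x h = @doubledLineThetaLift L _ _ _ 2 1 n e dV hdV dW hdW n'' e₁ hdV0 hdW0 lam⁻¹
          (K2LiuConjugateSymplecticInv.IsConjugateSymplectic.inv hlam) a' hρ (borel _) μW (𝓣 x) fw h) ∧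
      -- the value class `P ∋ T₁ x, T₂ x` and the rigidity data: ★ U2 `rankOneRigidity`'s binders at `N := ↥P`, `M := H(𝔸) → ℂ`, BY VALUE
      ∃ (P : Submodule ℂ (HA L e dV hdV dW hdW → ℂ)) (hP₁ : ∀ x, T₁ x ∈ P) (hP₂ : ∀ x, T₂ x ∈ P)
        (coeff : Matrix (Fin 2) (Fin 2) L → ↥P →ₗ[ℂ] (HA L e dV hdV dW hdW → ℂ))
        (R : Matrix (Fin 2) (Fin 2) L → (HA L e dV hdV dW hdW → ℂ) →ₗ[ℂ] (HA L e dV hdV dW hdW → ℂ))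
        (S : Matrix (Fin 2) (Fin 2) L → ↥(Submodule.span ℂ {x : piSchwartzBruhat (Fp L) (Fin (n' + n')) |
            ∃ a ∈ V, ∃ f : FinSB (Fp L) (Fin (n' + n')), x = piSchwartzBruhatEquiv (Fp L) (Fin (n' + n')) (a ⊗ₜ[ℂ] f)}) →ₗ[ℂ]
          ↥(Submodule.span ℂ {x : piSchwartzBruhat (Fp L) (Fin (n' + n')) |
              ∃ a ∈ V, ∃ f : FinSB (Fp L) (Fin (n' + n')), x = piSchwartzBruhatEquiv (Fp L) (Fin (n' + n')) (a ⊗ₜ[ℂ] f)})),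
        -- `hdet` (Hol.3c): a member of `P` all of whose non-zero hermitian coefficients vanish is `0`
        (∀ y : ↥P, (∀ β : Matrix (Fin 2) (Fin 2) L, (β.map (IsCMField.complexConj L))ᵀ = β → β ≠ 0 → coeff β y = 0) → y = 0) ∧
        -- `hT₁` `hT₂` (U3): automorphy of the coefficients under the rational Levi
        (∀ γ : Matrix (Fin 2) (Fin 2) L, IsUnit γ.det → ∀ β : Matrix (Fin 2) (Fin 2) L,
          coeff ((γ.map (IsCMField.complexConj L))ᵀ * β * γ) ∘ₗ LinearMap.codRestrict P T₁ hP₁ =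
            R γ ∘ₗ (coeff β ∘ₗ LinearMap.codRestrict P T₁ hP₁) ∘ₗ S γ) ∧
        (∀ γ : Matrix (Fin 2) (Fin 2) L, IsUnit γ.det → ∀ β : Matrix (Fin 2) (Fin 2) L,
          coeff ((γ.map (IsCMField.complexConj L))ᵀ * β * γ) ∘ₗ LinearMap.codRestrict P T₂ hP₂ =
            R γ ∘ₗ (coeff β ∘ₗ LinearMap.codRestrict P T₂ hP₂) ∘ₗ S γ) ∧
        -- `h2₁` `h2₂` (U2a through F-T1-coinv ∕ U4): no coefficients at non-degenerate hermitian `β`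
        (∀ β : Matrix (Fin 2) (Fin 2) L, (β.map (IsCMField.complexConj L))ᵀ = β → β.det ≠ 0 →
          coeff β ∘ₗ LinearMap.codRestrict P T₁ hP₁ = 0) ∧
        (∀ β : Matrix (Fin 2) (Fin 2) L, (β.map (IsCMField.complexConj L))ᵀ = β → β.det ≠ 0 →
          coeff β ∘ₗ LinearMap.codRestrict P T₂ hP₂ = 0) ∧
        -- `hfin₁` `hfin₂` (U2c-fin + archimedean signs, ONE SIDE EACH): a surviving rank-one index lies in the class of the line `a′`
        (∀ (b : (↥(maximalRealSubfield L))ˣ) (u : Fin 2 → L), (∃ k, u k = 1) →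
          coeff (algebraMap ↥(maximalRealSubfield L) L b • Matrix.vecMulVec (⇑(IsCMField.complexConj L) ∘ u) u) ∘ₗ
              LinearMap.codRestrict P T₁ hP₁ ≠ 0 →
          (∀ v : HeightOneSpectrum (𝓞 ↥(maximalRealSubfield L)),
              locF ↥(maximalRealSubfield L) (imagUnitSq L) b v = locF ↥(maximalRealSubfield L) (imagUnitSq L) a' v) ∧
            ∀ ρ : ↥(maximalRealSubfield L) →+* ℝ, 0 < ρ ((b : ↥(maximalRealSubfield L)) * ((a' : ↥(maximalRealSubfield L)))⁻¹)) ∧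
        (∀ (b : (↥(maximalRealSubfield L))ˣ) (u : Fin 2 → L), (∃ k, u k = 1) →
          coeff (algebraMap ↥(maximalRealSubfield L) L b • Matrix.vecMulVec (⇑(IsCMField.complexConj L) ∘ u) u) ∘ₗ
              LinearMap.codRestrict P T₂ hP₂ ≠ 0 →
          (∀ v : HeightOneSpectrum (𝓞 ↥(maximalRealSubfield L)),
              locF ↥(maximalRealSubfield L) (imagUnitSq L) b v = locF ↥(maximalRealSubfield L) (imagUnitSq L) a' v) ∧
            ∀ ρ : ↥(maximalRealSubfield L) →+* ℝ, 0 < ρ ((b : ↥(maximalRealSubfield L)) * ((a' : ↥(maximalRealSubfield L)))⁻¹)) ∧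
        -- `h₁` (U2b ∕ U2e through F-T1-coinv ∕ (F4)): at `β₀ = diag(a′, 0)` the residue side's coefficient is a MULTIPLE of the theta side's
        -- (`lam₀ := coeff β₀ ∘ T₂`, `c₂ := 1`; NO `hne`: ★ `rankOneRigidityDegenerate` closes the degenerate domains with `c := 0`) — this row PINS the weight `fw`
        ∃ c₁ : ℂ, coeff (Matrix.diagonal ![algebraMap ↥(maximalRealSubfield L) L a', 0]) ∘ₗ LinearMap.codRestrict P T₁ hP₁ =
          c₁ • (coeff (Matrix.diagonal ![algebraMap ↥(maximalRealSubfield L) L a', 0]) ∘ₗ LinearMap.codRestrict P T₂ hP₂)) :=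
  Iff.rfl

end Summit.HodgeConjecture.HodgeConjecture.Cruxes.HLiu418.K2LiuFirstTermIdentityFaceDefsIff

end
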